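import Summits.AtomisticToContinuum.Crystallization.Theorems.ThreeConeCertificateOnePercentCertificateReduction
import Summits.AtomisticToContinuum.Crystallization.Theorems.TruncatedCensusGap.Negative.KappaZeroHalf

/-!
# `OnePercentCertificate` (stmt-AtomisticToContinuum-11958) — the local constant as a PERIODIC ground-state bound

Supports file of the line `Sketch` (continuation lead c1).  The one open stub of the line,
`stub_local : ∀ N x, Injective x → -(cS·N) ≤ Σ_{i<j} gS(|x_i − x_j|)` (the finite-range part `gS` of the
explicit split of `Theorems/ThreeConeCertificateDefs.lean` is `cS`-stable on ALL finite configurations of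
distinct points), is implied by — and, for a finite-range potential, informally equivalent to — the
crystallization-type statement

  `∀ P : PeriodicConfiguration 3, -cS ≤ P.energyPerParticle gS`     ("periodic local constant")

(every periodic configuration of `ℝ³` has `gS`-energy per particle `≥ -cS ≈ -0.657987`; numerically the
minimum over periodic structures is hcp's `-0.651259`).  The implication is the tree's finite-range
periodisation identity (`exists_periodic_energyPerParticle_eq`, crux-disprover of `TruncatedCensusGap`):
an injective cluster placed in a cubic cell longer than its diameter plus the range `5/2` is a periodic
configuration with energy per particle exactly `E(y)/N`.

* `local_of_periodicLocalConstant` — the periodic local constant implies the registered stub `stub_local`'s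
  statement (registered on the item as stub `stub_local_of_periodic`);
* `onePercentCertificate_of_periodicLocalConstant` — hence the periodic local constant gives `OnePercentCertificate`
  (through the landed reduction `onePercentCertificate_of_local`).

So the crux is reduced to a pure statement about periodic configurations and the explicit finite-range pair
potential `gS` — the form in which the tree's periodic machinery (lattice sums, `KeplerBoundPeriodicMin`,
dilation identities) applies.  All `[folklore]`.
-/

noncomputable section

namespace Summit.AtomisticToContinuum.Crystallization.Theorems.OnePercentPeriodic

open scoped BigOperators
open Literature.MathematicalPhysics.StatisticalMechanics
open Summit.AtomisticToContinuum.Crystallization.Theorems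
open Summit.AtomisticToContinuum.Crystallization.Theorems.ThreeConeSplit

/-- **Periodic bound ⇒ finite stability.** If every periodic configuration has `gS`-energy per particle
`≥ -cS`, then `gS` is `cS`-stable on all finite configurations of distinct points: periodise the cluster
in a cubic cell longer than its diameter plus the range `5/2` (`exists_periodic_energyPerParticle_eq`, using
`gS ≡ 0` on `[5/2, ∞)`), whose energy per particle is exactly `E(y)/N`. [folklore] -/
theorem local_of_periodicLocalConstant
    (h : ∀ P : PeriodicConfiguration 3, -cS ≤ P.energyPerParticle gS) :
    ∀ (N : ℕ) (x : Fin N → EuclideanSpace ℝ (Fin 3)), Function.Injective x →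
      -(cS * (N : ℝ)) ≤ interactionEnergy gS x := by
  intro N x hx
  rcases Nat.eq_zero_or_pos N with hN | hN
  · subst hN
    rw [interactionEnergy_of_subsingleton]
    simp
  · obtain ⟨P, -, hP⟩ := exists_periodic_energyPerParticle_eq (V := gS) (R := 5 / 2)
      (fun r hr => gS_eq_zero hr) hx hN
    have hPc := h P
    rw [hP] at hPc
    have hNpos : (0 : ℝ) < N := by exact_mod_cast hN
    rw [le_div_iff₀ hNpos] at hPc
    linarith

/-- **The crux from the periodic local constant** (through `onePercentCertificate_of_local`). [folklore] -/
theorem onePercentCertificate_of_periodicLocalConstant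
    (h : ∀ P : PeriodicConfiguration 3, -cS ≤ P.energyPerParticle gS) :
    Summit.AtomisticToContinuum.Crystallization.Theses.ThreeConeCertificate.OnePercentCertificate :=
  OnePercentReduction.onePercentCertificate_of_local (local_of_periodicLocalConstant h)


/-- **Registered sub-goal `stub_local_of_periodic`** (the reduction of the line's stub `stub_local` to the
periodic local constant, verbatim as registered on the item). [folklore] -/
theorem stub_local_of_periodic : (∀ P : PeriodicConfiguration 3, -cS ≤ P.energyPerParticle gS) → ∀ (N : ℕ) (x : Fin N → EuclideanSpace ℝ (Fin 3)), Function.Injective x → -(cS * (N : ℝ)) ≤ interactionEnergy gS x :=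
  local_of_periodicLocalConstant

end Summit.AtomisticToContinuum.Crystallization.Theorems.OnePercentPeriodic
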